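import Literature.NumberTheory.EllipticCurves.TwoDescent
import Literature.NumberTheory.EllipticCurves.TianYuanZhang2017.CurveAFourTorsion
import Summits.BirchSwinnertonDyer.Rank1Residual.P2.CongruentNumberSilentEvenFiveThetaFourTorsion
import HarnessLib

/-!
# Route `PrintCf2`, crux stmt-BirchSwinnertonDyer-20509 `RamifiedOffTYZOfFacts` — VISIBILITY OF THE FROZEN HALF: over an `ℍ′_n` with
# COMMUTATIVE Galois group, a `K_n`-point `α = (X, Y)` of `A` with `X ∈ ℚ` and `X² + 4 ∉ ℚ^{×2} ∪ 2ℚ^{×2}` is NOT `2`-divisible modulo torsion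
# (cell `bsd-print-cf2`, LEAD of 20509 g16, line `offtyz-v7`, lineage cycle 17; fact-free, Theses-free, no `def`)

HONEST FRAMING (cell `bsd-print-cf2`, run/shared/lean/pub/bsd-print-cf2/; route `PrintCf2`; crux 20509 = `𝔅_ram → WAllCornerFTwoRamifiedOffTYZProved`,
DECIDING, OPEN AS A CLASS): pure algebra on TYZ's curve `A : Y² = X³ + 4X` (`curveA`) over the displayed number field `ℍ′_n = D.H ∋ i`
(`D : GenusPointData n`), the tree's complete `2`-descent (`Literature/…/TwoDescent`, Silverman X.1.4) and Galois theory; the displayed Lemma 3.18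
(`D.lemma318`, odd `n`: the torsion of `A(ℍ′_n)` is killed by `4` and its double lies in `{0, τ(1)}`) and a complex conjugation `c` (the object of the
displayed `ConjSpec`) enter as HYPOTHESES, and so does the COMMUTATIVITY of `Gal(ℍ′_n/ℚ)` (on the block-free family — `n ≡ 7 (mod 8)` with no divisor
`≡ 5 (mod 8)` — this is the printed definition `ℍ′_n := L_n(i)·∏_{d₀ ≡ 5,6} H′_{d₀} = L_n(i)`, typed as the display `CompositumSpec` /
`tyz_cmPointCompositumData` of `TianYuanZhang2017/CMPointCompositumDisplays.lean`, p759295; the consumer file `…LowerHalfVisibleSeven` does the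
packaging).  Nothing is asserted; no named fact is introduced here.

WHY (the LEAD's reading, `Cruxes/RamifiedOffTYZOfFacts/Lines/offtyz_v7_Visibility.md`): after g11–g15 the LOWER half of C⁺ (`2 ∣ 𝓛(n)`) is a
kernel theorem exactly OFF the special stratum `ρ(n) = 0`, where the half `Q₁ ≡ α_n` (a generator of the free part of `A(K_n)⁻`) is FROZEN
(`…GenusCharacterRho`) and the one remaining in-`ℍ′_n` handle is g2's VISIBILITY theorem `LevelTwoModTwo.two_pow_dvd_of_isScriptL_of_generator_not_twoDivisible`:
**`α_n ∉ 2A(ℍ′_n) + A(ℍ′_n)_tor ⟹ 2^{ρ+1} ∣ 𝓛(n)`, with NO Selmer hypothesis** — never discharged (g2's instrument ask (271), g15's successor item (iii)).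
THIS FILE discharges its hypothesis from an explicit rational condition when `Gal(ℍ′_n/ℚ)` is commutative:

* §1 (Galois norm lemma, `exists_sq_eq_norm_of_sq_eq`): if every automorphism of `ℍ′_n` commutes with `c` (`c(i) = −i`, `c² = 1`) and
  `s² = a + b·i` with `a, b ∈ ℚ`, then **`a² + b² ∈ ℚ²`** (`s·c(s)` is fixed by every automorphism — `g(s) = ±s` or `±c(s)` — hence rational, and
  its square is `(a + bi)(a − bi)`).
* §2 (`2`-descent of `A` over `ℍ′_n`): `A` has the rational `2`-torsion `2i, 0, −2i` over `ℍ′_n` (`splitTwoTorsion_curveA`); the descent component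
  `δ` at `T = (2i, 0)` (`P ↦ [X(P) − 2i] ∈ ℍ′_n^×/ℍ′_n^{×2}`) is a homomorphism killing `2A(ℍ′_n)`; its values on the eight points `t` with `4t = 0`,
  `2t ∈ {0, τ(1)}` (Lemma 3.18 + the tree's `eq_of_two_nsmul_eq_zero` / `eq_of_two_nsmul_eq_tauOne`) are `[1], [−2i], [−8], [−4i], [2 − 2i], [−2 − 2i]`.
* §3 (`exists_sq_add_four_of_twoDivisible`): hence if `α = (X, Y)` with `X ∈ ℚ` is `2`-divisible modulo torsion in `A(ℍ′_n)`, then `(X − 2i)·w` is a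
  square in `ℍ′_n` for one of these six `w`, and §1 turns this into **`X² + 4 ∈ ℚ^{×2}` or `X² + 4 ∈ 2ℚ^{×2}`** (the norms are `N(w)·(X² + 4)` with
  `N(w) ∈ {1, 4, 64, 16, 8, 8}`).  Contrapositive `not_twoDivisible_of_sq_add_four`: **`X² + 4 ∉ ℚ² ∪ 2ℚ²` ⟹ `α ∉ 2A(ℍ′_n) + A(ℍ′_n)_tor`.**

Reading for the line: for `α = Θ_A(h)`, `h = (X_h, Y_h) ∈ A_n(ℚ)` (`A_n : Y² = X³ + 4n²X`), `X = −X_h/n` and `X² + 4 = Y_h²/(n²X_h) ≡ X_h (mod ℚ^{×2})`, so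
the condition reads «`X_h ∉ ℚ² ∪ 2ℚ²`», i.e. the `2`-isogeny descent class `d(h)` of the `A_n`-generator is neither `1` (that is `ρ(n) = 1`) nor `2`: on the
block-free family the lower half of C⁺ therefore holds on the special stratum except where `d(h) = 2` (consumer file).  Beyond print: YES, as a theorem
about TYZ's objects (conditional on the displays); C⁺ itself stays open.  BSD is not proved by any of this; no class is closed by this file.

References: [cite: TianYuanZhang2017, §3.1 (p0011 L27–L36, L58–L66), Lemma 3.16 (p0017 L98–L113), Lemma 3.18 (p0017 L152–L153), Thm. 3.6 (p0012 L22–L36)];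
[cite: SilvermanAEC2009, Prop. X.1.4]; [cite: Knapp1993, Thm. 4.2]; [cite: Lang2002, VI §1 Thm. 1.2, Cor. 1.4]; tree: `Literature/…/TwoDescent.lean`,
`TianYuanZhang2017/CurveAFourTorsion.lean`, `Rank1Residual/P2/CongruentNumberSilentEvenFiveThetaFourTorsion.lean` (`eq_of_two_nsmul_eq_tauOne`),
`Theorems/PrintCf2RamifiedOffTYZLevelTwoModTwo.lean` (g2, the consumer's door).
-/

noncomputable section

open scoped Classical

open WeierstrassCurve WeierstrassCurve.Affine WeierstrassCurve.Affine.Point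
  Literature.NumberTheory.EllipticCurves Literature.NumberTheory.EllipticCurves.TianYuanZhang2017
  Summit.BirchSwinnertonDyer.Rank1Residual.P2.ThetaDescent

set_option autoImplicit false

namespace Summit.BirchSwinnertonDyer.PrintCf2.VisibleGenerator

variable {n : ℕ}

/-! ## §1 The Galois norm lemma: a square root of `a + b i` in a field whose automorphisms commute with `c` forces `a² + b² ∈ ℚ²` -/

/-- An automorphism of `ℍ′_n` maps `i` to `±i`. [cite: TianYuanZhang2017, §3.1 (p0011 L64)] -/
private theorem im_eq_or (D : GenusPointData n) (g : D.H ≃ₐ[ℚ] D.H) : g D.im = D.im ∨ g D.im = -D.im := by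
  have h2 : (g D.im) ^ 2 = D.im ^ 2 := by rw [← map_pow, D.im_sq, map_neg, map_one]
  have h0 : (g D.im - D.im) * (g D.im + D.im) = 0 := by linear_combination h2
  rcases mul_eq_zero.mp h0 with h | h
  · exact Or.inl (by linear_combination h)
  · exact Or.inr (by linear_combination h)

/-- `i ≠ 0` in `ℍ′_n`. [cite: TianYuanZhang2017, §3.1 (p0011 L64)] -/
private theorem im_ne_zero' (D : GenusPointData n) : D.im ≠ 0 := by
  intro h
  have := D.im_sq
  rw [h] at this
  norm_num at this

/-- `u² = v²` forces `u = ±v`. [folklore] -/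
private theorem eq_or_eq_neg_of_sq_eq' {F : Type*} [Field F] {u v : F} (h : u ^ 2 = v ^ 2) : u = v ∨ u = -v := by
  have h0 : (u - v) * (u + v) = 0 := by linear_combination h
  rcases mul_eq_zero.mp h0 with h | h
  · exact Or.inl (by linear_combination h)
  · exact Or.inr (by linear_combination h)

/-- **THE GALOIS NORM LEMMA.**  `ℍ′_n ∋ i` Galois over `ℚ`; `c` an automorphism with `c(i) = −i`, `c² = 1`, COMMUTING with every automorphism.
If `s ∈ ℍ′_n` has `s² = a + b·i` (`a, b ∈ ℚ`), then `a² + b² = q²` for a rational `q` (namely `q = s·c(s) ∈ ℍ′_n^{Gal} = ℚ`).  So in a field with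
commutative Galois group the only elements of `ℚ(i)` that become squares have norm in `ℚ^{×2}`.
[cite: Lang2002, VI §1 Thm. 1.2, Cor. 1.4] [cite: TianYuanZhang2017, §3.1 (p0011 L58–L66)] -/
theorem exists_sq_eq_norm_of_sq_eq (D : GenusPointData n) (c : D.H ≃ₐ[ℚ] D.H) (hci : c D.im = -D.im) (hcc : c * c = 1)
    (hcomm : ∀ g : D.H ≃ₐ[ℚ] D.H, g * c = c * g) {a b : ℚ} {s : D.H}
    (hs : s ^ 2 = algebraMap ℚ D.H a + algebraMap ℚ D.H b * D.im) : ∃ q : ℚ, a ^ 2 + b ^ 2 = q ^ 2 := by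
  have hcs2 : (c s) ^ 2 = algebraMap ℚ D.H a - algebraMap ℚ D.H b * D.im := by
    rw [← map_pow, hs, map_add, map_mul, AlgEquiv.commutes, AlgEquiv.commutes, hci]; ring
  have hccs : c (c s) = s := by rw [← AlgEquiv.mul_apply, hcc, AlgEquiv.one_apply]
  -- `u = s·c(s)` is fixed by every automorphism
  have hfix : ∀ g : D.H ≃ₐ[ℚ] D.H, g (s * c s) = s * c s := by
    intro g
    have hgc : g (c s) = c (g s) := by rw [← AlgEquiv.mul_apply, hcomm g, AlgEquiv.mul_apply]
    rcases im_eq_or D g with hgi | hgi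
    · -- `g` fixes `i`: `(g s)² = s²`
      have h2 : (g s) ^ 2 = s ^ 2 := by
        rw [← map_pow, hs, map_add, map_mul, AlgEquiv.commutes, AlgEquiv.commutes, hgi]
      rcases eq_or_eq_neg_of_sq_eq' h2 with e | e
      · rw [map_mul, hgc, e]
      · rw [map_mul, hgc, e, map_neg]; ring
    · -- `g` flips `i`: `(g s)² = (c s)²`
      have h2 : (g s) ^ 2 = (c s) ^ 2 := by
        rw [← map_pow, hs, map_add, map_mul, AlgEquiv.commutes, AlgEquiv.commutes, hgi, hcs2]; ring
      rcases eq_or_eq_neg_of_sq_eq' h2 with e | e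
      · rw [map_mul, hgc, e, hccs]; ring
      · rw [map_mul, hgc, e, map_neg, hccs]; ring
  obtain ⟨q, hq⟩ := IntermediateField.mem_bot.mp ((IsGalois.mem_bot_iff_fixed (s * c s)).mpr hfix)
  refine ⟨q, (algebraMap ℚ D.H).injective ?_⟩
  rw [map_pow, hq, mul_pow, hs, hcs2, map_add, map_pow, map_pow]
  linear_combination (algebraMap ℚ D.H b) ^ 2 * D.im_sq

/-! ## §2 The complete `2`-descent of `A : Y² = X³ + 4X` over `ℍ′_n ∋ i`: rational `2`-torsion `2i, 0, −2i`, the component at `(2i, 0)` -/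

/-- `A` over `ℍ′_n` has the rational `2`-torsion abscissae `2i, 0, −2i` (in this order: the descent component used below is the one at `T = (2i, 0)`,
`P ↦ [X(P) − 2i]`). [cite: SilvermanAEC2009, Prop. X.1.4] [cite: TianYuanZhang2017, Lemma 3.16 (p0017 L98–L101)] -/
theorem splitTwoTorsion_curveA (D : GenusPointData n) :
    (curveA.baseChange D.H).toAffine.SplitTwoTorsion (2 * D.im) 0 (-(2 * D.im)) := by
  have him := D.im_sq
  have hb₂ : (curveA.baseChange D.H).toAffine.b₂ = 0 := by
    simp [WeierstrassCurve.b₂, curveA, WeierstrassCurve.baseChange]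
  have hb₄ : (curveA.baseChange D.H).toAffine.b₄ = 8 := by
    simp [WeierstrassCurve.b₄, curveA, WeierstrassCurve.baseChange]; norm_num
  have hb₆ : (curveA.baseChange D.H).toAffine.b₆ = 0 := by
    simp [WeierstrassCurve.b₆, curveA, WeierstrassCurve.baseChange]
  refine ⟨?_, ?_, ?_⟩
  · rw [hb₂]; ring
  · rw [hb₄]; linear_combination (8 : D.H) * him
  · rw [hb₆]; ring

/-- `A/ℍ′_n` is an elliptic curve (instance plumbing for the descent homomorphism). [folklore] -/
private theorem isElliptic_curveA_baseChange (D : GenusPointData n) : (curveA.baseChange D.H).IsElliptic :=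
  inferInstanceAs (curveA.map (algebraMap ℚ D.H)).IsElliptic

/-- The descent component `δ(P) = [X(P) − 2i]` at `T = (2i, 0)` kills `2A(ℍ′_n)`: `δ(P + 2y) = δ(P)`. [cite: SilvermanAEC2009, Prop. X.1.4] -/
private theorem δ_add_two_zsmul (D : GenusPointData n) (P y : APoint D.H) :
    twoDescentComponent (curveA.baseChange D.H).toAffine (2 * D.im) 0 (-(2 * D.im)) (P + (2 : ℤ) • y) =
      twoDescentComponent (curveA.baseChange D.H).toAffine (2 * D.im) 0 (-(2 * D.im)) P := by
  haveI := isElliptic_curveA_baseChange D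
  have h := splitTwoTorsion_curveA D
  rw [two_zsmul, twoDescentComponent_add h, twoDescentComponent_add h, SqUnits.mul_self, SqUnits.mul_one]

/-- A rational abscissa is never `2i`: `X ∈ ℚ ⟹ X ≠ 2i` in `ℍ′_n`. [folklore] -/
private theorem algebraMap_ne_two_mul_im (D : GenusPointData n) (X : ℚ) : algebraMap ℚ D.H X ≠ 2 * D.im := by
  intro h
  have h2 : algebraMap ℚ D.H (X ^ 2) = algebraMap ℚ D.H (-4) := by
    rw [map_pow, h, mul_pow, D.im_sq, map_neg, map_ofNat]; norm_num
  have h3 : X ^ 2 = -4 := (algebraMap ℚ D.H).injective h2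
  nlinarith [sq_nonneg X]

/-- `δ(X, Y) = [X − 2i]` for a rational abscissa `X`. [cite: SilvermanAEC2009, Prop. X.1.4] -/
private theorem δ_some_rat (D : GenusPointData n) {X : ℚ} {Y : D.H}
    (hP : (curveA.baseChange D.H).toAffine.Nonsingular (algebraMap ℚ D.H X) Y) :
    twoDescentComponent (curveA.baseChange D.H).toAffine (2 * D.im) 0 (-(2 * D.im)) (Point.some _ _ hP) =
      sqClass (algebraMap ℚ D.H X - 2 * D.im) :=
  twoDescentComponent_some_of_ne hP (algebraMap_ne_two_mul_im D X)

/-- **The values of `δ` on the points `t` with `2t = 0`**: `δ(O) = [1]`, `δ(0,0) = [−2i]`, `δ(2i,0) = [−8]`, `δ(−2i,0) = [−4i]` — in the form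
«`δ(t) = [w]` for some `w ∈ {1, −2i, −8, −4i}`». [cite: SilvermanAEC2009, Prop. X.1.4] [cite: TianYuanZhang2017, Lemma 3.16 (p0017 L98–L101)] -/
private theorem δ_of_two_nsmul_eq_zero (D : GenusPointData n) {t : APoint D.H} (ht : (2 : ℕ) • t = 0) :
    twoDescentComponent (curveA.baseChange D.H).toAffine (2 * D.im) 0 (-(2 * D.im)) t = sqClass (1 : D.H) ∨
      twoDescentComponent (curveA.baseChange D.H).toAffine (2 * D.im) 0 (-(2 * D.im)) t = sqClass (-(2 * D.im)) ∨
      twoDescentComponent (curveA.baseChange D.H).toAffine (2 * D.im) 0 (-(2 * D.im)) t = sqClass (-8 : D.H) ∨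
      twoDescentComponent (curveA.baseChange D.H).toAffine (2 * D.im) 0 (-(2 * D.im)) t = sqClass (-(4 * D.im)) := by
  have him := D.im_sq
  have hi0 : D.im ≠ 0 := im_ne_zero' D
  have h11 : sqClass (1 : D.H) = 1 := by simpa using sqClass_mul_self (1 : D.H)
  rcases TianYuanZhang2017.eq_of_two_nsmul_eq_zero D.im D.im_sq ht with rfl | rfl | rfl | rfl
  · left; rw [twoDescentComponent_zero, h11]
  · right; left
    have hx : (0 : D.H) ≠ 2 * D.im := fun h => hi0 (by linear_combination (-1/2 : D.H) * h)
    rw [tauOne, twoDescentComponent_some_of_ne _ hx, zero_sub]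
  · right; right; left
    rw [ptTwoI, twoDescentComponent_some_of_eq _ rfl]
    congr 1
    linear_combination (8 : D.H) * him
  · right; right; right
    have hx : -(2 * D.im) ≠ 2 * D.im := fun h => hi0 (by linear_combination (-1/4 : D.H) * h)
    rw [ptNegTwoI, twoDescentComponent_some_of_ne _ hx]
    congr 1; ring

/-- **The values of `δ` on the points `t` with `2t = τ(1)`** (`t ∈ {±τ(½), ±τ(i/2)} = {(2, ±4), (−2, ±4i)}`): `δ(t) = [2 − 2i]` or `[−2 − 2i]`.
[cite: SilvermanAEC2009, Prop. X.1.4] [cite: TianYuanZhang2017, §3.2 (p0012 L12–L18), Lemma 3.16 (p0017 L98–L113)] -/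
private theorem δ_of_two_nsmul_eq_tauOne (D : GenusPointData n) {t : APoint D.H} (ht : (2 : ℕ) • t = tauOne) :
    twoDescentComponent (curveA.baseChange D.H).toAffine (2 * D.im) 0 (-(2 * D.im)) t = sqClass (2 - 2 * D.im) ∨
      twoDescentComponent (curveA.baseChange D.H).toAffine (2 * D.im) 0 (-(2 * D.im)) t = sqClass (-2 - 2 * D.im) := by
  have him := D.im_sq
  have h2 : (2 : D.H) ≠ 2 * D.im := by
    intro h
    have : D.im = 1 := by linear_combination (-1/2 : D.H) * h
    rw [this] at him; norm_num at him
  have hm2 : (-2 : D.H) ≠ 2 * D.im := by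
    intro h
    have : D.im = -1 := by linear_combination (-1/2 : D.H) * h
    rw [this] at him; norm_num at him
  have hτ : twoDescentComponent (curveA.baseChange D.H).toAffine (2 * D.im) 0 (-(2 * D.im)) tauHalf = sqClass (2 - 2 * D.im) := by
    rw [tauHalf, twoDescentComponent_some_of_ne _ h2]
  have hiτ : twoDescentComponent (curveA.baseChange D.H).toAffine (2 * D.im) 0 (-(2 * D.im)) (cmI D.im D.im_sq tauHalf) =
      sqClass (-2 - 2 * D.im) := by
    rw [tauHalf, cmI_some, twoDescentComponent_some_of_ne _ hm2]
  rcases Summit.BirchSwinnertonDyer.Rank1Residual.P2.ThetaDescent.eq_of_two_nsmul_eq_tauOne D.im D.im_sq t ht with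
    rfl | rfl | rfl | rfl
  · exact Or.inl hτ
  · left; rw [twoDescentComponent_neg]; exact hτ
  · exact Or.inr hiτ
  · right; rw [twoDescentComponent_neg]; exact hiτ

/-- From `[u] = [w]` with `u, w ≠ 0`: `u·w` is a square. [folklore] -/
private theorem exists_sq_of_sqClass_eq {F : Type*} [Field F] {u w : F} (hu : u ≠ 0) (hw : w ≠ 0) (h : sqClass u = sqClass w) :
    ∃ s : F, u * w = s ^ 2 := by
  have h1 : sqClass (u * w) = 1 := by rw [sqClass_mul hu hw, h, SqUnits.mul_self]
  exact (sqClass_eq_one_iff (mul_ne_zero hu hw)).mp h1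

/-! ## §3 The criterion: `2`-divisible modulo torsion ⟹ `X² + 4 ∈ ℚ² ∪ 2ℚ²` -/

/-- **`2`-DIVISIBILITY MODULO TORSION IS VISIBLE ON `X² + 4`.**  Odd `n`, data `D` with Lemma 3.18 (`A(ℍ′_n)_tor`: `4t = 0`, `2t ∈ {0, τ(1)}`), a
complex conjugation `c` (`c(i) = −i`, `c² = 1`) commuting with every automorphism of `ℍ′_n`.  If an `ℍ′_n`-point `α = (X, Y)` of `A` with RATIONAL
abscissa `X` is `2`-divisible modulo torsion (`α − 2y ∈ A(ℍ′_n)_tor` for some `y`), then **`X² + 4 = q²` or `X² + 4 = 2q²` for a rational `q`**.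
(`δ(α) = δ(t)` for the torsion point `t = α − 2y`; §2 lists `δ(t) = [w]`; so `(X − 2i)·w = s²`, and §1 gives `N(X − 2i)·N(w) = (X² + 4)·N(w) ∈ ℚ²`
with `N(w) ∈ {1, 4, 64, 16, 8, 8}`.)
[cite: SilvermanAEC2009, Prop. X.1.4] [cite: TianYuanZhang2017, Lemma 3.18 (p0017 L152–L153), Lemma 3.16 (p0017 L98–L113)] [cite: Lang2002, VI §1 Thm. 1.2] -/
theorem exists_sq_add_four_of_twoDivisible (D : GenusPointData n) (hodd : Odd n) (h318 : D.lemma318)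
    (c : D.H ≃ₐ[ℚ] D.H) (hci : c D.im = -D.im) (hcc : c * c = 1) (hcomm : ∀ g : D.H ≃ₐ[ℚ] D.H, g * c = c * g)
    {X : ℚ} {Y : D.H} (hP : (curveA.baseChange D.H).toAffine.Nonsingular (algebraMap ℚ D.H X) Y)
    (h2 : ∃ y : APoint D.H, IsOfFinAddOrder ((Point.some _ _ hP : APoint D.H) - (2 : ℤ) • y)) :
    ∃ q : ℚ, X ^ 2 + 4 = q ^ 2 ∨ X ^ 2 + 4 = 2 * q ^ 2 := by
  have him := D.im_sq
  have hi0 : D.im ≠ 0 := im_ne_zero' D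
  obtain ⟨y, ht⟩ := h2
  set t : APoint D.H := Point.some _ _ hP - (2 : ℤ) • y with htdef
  -- `δ(α) = δ(t)`
  have hPt : (Point.some _ _ hP : APoint D.H) = t + (2 : ℤ) • y := by rw [htdef, sub_add_cancel]
  have hδ : sqClass (algebraMap ℚ D.H X - 2 * D.im) =
      twoDescentComponent (curveA.baseChange D.H).toAffine (2 * D.im) 0 (-(2 * D.im)) t := by
    rw [← δ_some_rat D hP, hPt, δ_add_two_zsmul]
  have hu : algebraMap ℚ D.H X - 2 * D.im ≠ 0 := sub_ne_zero.mpr (algebraMap_ne_two_mul_im D X)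
  -- the norm bookkeeping: `(X − 2i)·w = s²` with `w` of norm `N`, `a + b i := (X − 2i)·w` ⟹ `(X²+4)·N = q²`
  have key : ∀ (w : D.H) (a b N : ℚ), w ≠ 0 →
      twoDescentComponent (curveA.baseChange D.H).toAffine (2 * D.im) 0 (-(2 * D.im)) t = sqClass w →
      (algebraMap ℚ D.H X - 2 * D.im) * w = algebraMap ℚ D.H a + algebraMap ℚ D.H b * D.im →
      a ^ 2 + b ^ 2 = N * (X ^ 2 + 4) → ∃ q : ℚ, (X ^ 2 + 4) * N = q ^ 2 := by
    intro w a b N hw hcl hab hN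
    obtain ⟨s, hs⟩ := exists_sq_of_sqClass_eq hu hw (hδ.trans hcl)
    obtain ⟨q, hq⟩ := exists_sq_eq_norm_of_sq_eq D c hci hcc hcomm (s := s) (a := a) (b := b) (by rw [← hs, hab])
    exact ⟨q, by rw [← hq, hN]; ring⟩
  -- Lemma 3.18: `2t = 0` or `2t = τ(1)`
  obtain ⟨-, h2t⟩ := h318.1 hodd t ht
  rcases h2t with h0 | h1
  · rcases δ_of_two_nsmul_eq_zero D h0 with e | e | e | e
    · -- `w = 1`, `N = 1`
      obtain ⟨q, hq⟩ := key 1 X (-2) 1 one_ne_zero e (by simp only [map_neg, map_ofNat]; ring) (by ring)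
      exact ⟨q, Or.inl (by linear_combination hq)⟩
    · -- `w = −2i`, `N = 4`
      obtain ⟨q, hq⟩ := key (-(2 * D.im)) (-4) (-2 * X) 4 (neg_ne_zero.mpr (mul_ne_zero two_ne_zero hi0)) e
        (by simp only [map_neg, map_mul, map_ofNat]; linear_combination (4 : D.H) * him) (by ring)
      exact ⟨q / 2, Or.inl (by linear_combination hq / 4)⟩
    · -- `w = −8`, `N = 64`
      obtain ⟨q, hq⟩ := key (-8) (-8 * X) 16 64 (by norm_num) e
        (by simp only [map_neg, map_mul, map_ofNat]; ring) (by ring)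
      exact ⟨q / 8, Or.inl (by linear_combination hq / 64)⟩
    · -- `w = −4i`, `N = 16`
      obtain ⟨q, hq⟩ := key (-(4 * D.im)) (-8) (-4 * X) 16 (neg_ne_zero.mpr (mul_ne_zero (by norm_num) hi0)) e
        (by simp only [map_neg, map_mul, map_ofNat]; linear_combination (8 : D.H) * him) (by ring)
      exact ⟨q / 4, Or.inl (by linear_combination hq / 16)⟩
  · rcases δ_of_two_nsmul_eq_tauOne D h1 with e | e
    · -- `w = 2 − 2i`, `N = 8`
      have hw : (2 : D.H) - 2 * D.im ≠ 0 := by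
        intro h
        have : D.im = 1 := by linear_combination (-1/2 : D.H) * h
        rw [this] at him; norm_num at him
      obtain ⟨q, hq⟩ := key (2 - 2 * D.im) (2 * X - 4) (-2 * X - 4) 8 hw e
        (by simp only [map_neg, map_mul, map_sub, map_ofNat]; linear_combination (4 : D.H) * him) (by ring)
      exact ⟨q / 4, Or.inr (by linear_combination hq / 8)⟩
    · -- `w = −2 − 2i`, `N = 8`
      have hw : (-2 : D.H) - 2 * D.im ≠ 0 := by
        intro h
        have : D.im = -1 := by linear_combination (-1/2 : D.H) * h
        rw [this] at him; norm_num at him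
      obtain ⟨q, hq⟩ := key (-2 - 2 * D.im) (-2 * X - 4) (-2 * X + 4) 8 hw e
        (by simp only [map_neg, map_mul, map_sub, map_add, map_ofNat]; linear_combination (4 : D.H) * him) (by ring)
      exact ⟨q / 4, Or.inr (by linear_combination hq / 8)⟩

/-- **VISIBILITY CRITERION (contrapositive).**  Same hypotheses; if `X² + 4` is neither a rational square nor twice a rational square, then the point
`α = (X, Y)` is NOT `2`-divisible modulo torsion in `A(ℍ′_n)` — the hypothesis `α ∉ 2A(ℍ′_n) + A(ℍ′_n)_tor` of g2's
`LevelTwoModTwo.two_pow_dvd_of_isScriptL_of_generator_not_twoDivisible`.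
[cite: SilvermanAEC2009, Prop. X.1.4] [cite: TianYuanZhang2017, Lemma 3.18 (p0017 L152–L153)] [cite: Lang2002, VI §1 Thm. 1.2] -/
theorem not_twoDivisible_of_sq_add_four (D : GenusPointData n) (hodd : Odd n) (h318 : D.lemma318)
    (c : D.H ≃ₐ[ℚ] D.H) (hci : c D.im = -D.im) (hcc : c * c = 1) (hcomm : ∀ g : D.H ≃ₐ[ℚ] D.H, g * c = c * g)
    {X : ℚ} {Y : D.H} (hP : (curveA.baseChange D.H).toAffine.Nonsingular (algebraMap ℚ D.H X) Y)
    (hX : ¬ ∃ q : ℚ, X ^ 2 + 4 = q ^ 2 ∨ X ^ 2 + 4 = 2 * q ^ 2) :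
    ¬ ∃ y : APoint D.H, IsOfFinAddOrder ((Point.some _ _ hP : APoint D.H) - (2 : ℤ) • y) :=
  fun h2 => hX (exists_sq_add_four_of_twoDivisible D hodd h318 c hci hcc hcomm hP h2)

end Summit.BirchSwinnertonDyer.PrintCf2.VisibleGenerator

end
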